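import Summits.Ventures.Crystal3D.Theorems.StickyWulffConstantGenericWallFloorSlotDozens
import HarnessLib

/-!
# Shell trichotomy (E2, packing currency): a close-packed contact shell over a non-coplanar own pattern
# is the grain's full slot dozen or an exact twin cap (crux `GenericWallFloor`, line `WallLedgerG`)

HONEST FRAMING. Part of the venture `Summits/Ventures/Crystal3D` (cell `crystal3d-full`), helper
`--supports` the crux `GenericWallFloor` (stmt-Ventures-19480) of `route-Ventures-StickyWulffConstant`,
registered line `WallLedgerG` (planner cf-p1 gen 16/22), open stub `stub_twoSlabAdhesion` — general-filling
step, per-ball programme E2 (cf-p1 ROUTE.md §80(9) TRICHOTOMY: «for `u ∈ X_f` with certified pattern: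
unsaturated, or interior, or exact twin cap»).

SETTING (no cell, no plates; arbitrary foreign balls).  `X` a finite configuration, `A` the grain frame
(slots `u + A w`, `w ∈ fccSlots`), and the contact shell of `u` is a CLOSE-PACKED DOZEN `u + B(P)`,
`P ∈ {fccKissingPattern, hcpKissingPattern}`, `B` a linear isometry — the output of
`exists_frame_of_allButOne` (…SaturationStructure: GAP + CLASSIFICATION, all-but-one saturated neighbours)
or of `ExactOnly` + twelve contacts (…ExactOnly, E1 certificates).  If three LINEARLY INDEPENDENT slots of
`u` are occupied, then (`slots_full_or_twinCap_of_closePackedShell`):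

* fcc type (`slots_full_of_fccShell`): ALL twelve slots `u + A w` are occupied — `u` is interior;
* hcp type (`twinCap_of_hcpShell`): `u` is an EXACT TWIN CAP — for a unit `{111}` normal `n` of the grain
  (`⟪A w, n⟫ ∈ {0, ±√(2/3)}`) the nine slots with `⟪A w, n⟫ ≤ 0` are occupied, the three with
  `⟪A w, n⟫ > 0` are EMPTY and their twin images `u − A w + 2⟪A w, n⟫ n` are occupied — literally the
  conclusion of 19480-p1's `exit_twinCap_of_patch`, obtained here from the SHAPE of the shell alone
  (no full-shell predecessor, no radius-2 Barlow patch);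
* `twinCap_of_closePackedShell_of_empty_slot`: with one empty slot, the twin cap is forced.

Source of the rigidity: `fccDozen_eq_slots_of_three_independent` / `hcpDozen_twin_of_three_independent`
(…SlotDozens).  No `|O| ≥ 7` threshold: any non-coplanar own pattern.

WHAT THIS IS NOT: no saturation / credit statement (E1, E3); not the stub; rung F-C1 not moved.
-/

noncomputable section

namespace Summit.Ventures.Crystal3D.Theorems

open Literature.Geometry.DiscreteGeometry Finset
open scoped InnerProductSpace

variable {X : Finset (EuclideanSpace ℝ (Fin 3))}

/-- From «`u + A w ∈ X`» to «`A w` is a vector of the contact dozen `B(P)`». -/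
theorem slot_mem_dozen_of_mem
    (A : EuclideanSpace ℝ (Fin 3) ≃ₗᵢ[ℝ] EuclideanSpace ℝ (Fin 3))
    (B : EuclideanSpace ℝ (Fin 3) →ₗᵢ[ℝ] EuclideanSpace ℝ (Fin 3)) {P : Finset (EuclideanSpace ℝ (Fin 3))}
    {u : EuclideanSpace ℝ (Fin 3)}
    (hshell : ∀ q ∈ X, dist u q = 1 → ∃ p ∈ P, q = u + B p)
    {w : EuclideanSpace ℝ (Fin 3)} (hw : w ∈ fccSlots) (hX : u + A w ∈ X) :
    A w ∈ B '' (↑P : Set (EuclideanSpace ℝ (Fin 3))) ∧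
      A w ∈ A '' (↑fccSlots : Set (EuclideanSpace ℝ (Fin 3))) := by
  have hd : dist u (u + A w) = 1 := by
    rw [dist_self_add_right, LinearIsometryEquiv.norm_map, norm_eq_one_of_mem_fccSlots hw]
  obtain ⟨p, hp, he⟩ := hshell _ hX hd
  exact ⟨⟨p, hp, (add_left_cancel he).symm⟩, ⟨w, hw, rfl⟩⟩

/-- **Shell rigidity, fcc type.**  If the contact shell of `u` is the fcc dozen `u + B(fccKissingPattern)`
and contains three linearly independent slots `u + A wᵢ` of the grain `A`, then ALL twelve slots
`u + A w` are occupied (the shell is the grain's own dozen: `u` is an interior ball of the grain). -/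
theorem slots_full_of_fccShell
    (A : EuclideanSpace ℝ (Fin 3) ≃ₗᵢ[ℝ] EuclideanSpace ℝ (Fin 3))
    (B : EuclideanSpace ℝ (Fin 3) →ₗᵢ[ℝ] EuclideanSpace ℝ (Fin 3)) {u : EuclideanSpace ℝ (Fin 3)}
    (hmem : ∀ p ∈ fccKissingPattern, u + B p ∈ X)
    (hshell : ∀ q ∈ X, dist u q = 1 → ∃ p ∈ fccKissingPattern, q = u + B p)
    {w₁ w₂ w₃ : EuclideanSpace ℝ (Fin 3)} (hw₁ : w₁ ∈ fccSlots) (hw₂ : w₂ ∈ fccSlots) (hw₃ : w₃ ∈ fccSlots)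
    (h₁ : u + A w₁ ∈ X) (h₂ : u + A w₂ ∈ X) (h₃ : u + A w₃ ∈ X)
    (hind : LinearIndependent ℝ ![w₁, w₂, w₃]) :
    ∀ w ∈ fccSlots, u + A w ∈ X := by
  obtain ⟨a₁, a₂⟩ := slot_mem_dozen_of_mem A B hshell hw₁ h₁
  obtain ⟨b₁, b₂⟩ := slot_mem_dozen_of_mem A B hshell hw₂ h₂
  obtain ⟨c₁, c₂⟩ := slot_mem_dozen_of_mem A B hshell hw₃ h₃
  have hdoz := fccDozen_eq_slots_of_three_independent A B a₁ b₁ c₁ a₂ b₂ c₂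
    (linearIndependent_map_triple A hind)
  intro w hw
  have : A w ∈ B '' (↑fccKissingPattern : Set (EuclideanSpace ℝ (Fin 3))) := by
    rw [hdoz]; exact ⟨w, hw, rfl⟩
  obtain ⟨p, hp, he⟩ := this
  rw [← he]
  exact hmem p hp

/-- **Shell rigidity, hcp type: the exact twin cap.**  If the contact shell of `u` is the hcp dozen
`u + B(hcpKissingPattern)` and contains three linearly independent slots `u + A wᵢ` of the grain `A`,
then `u` is an EXACT TWIN CAP of the grain: for a unit `{111}` normal `n` (`⟪A w, n⟫ ∈ {0, ±√(2/3)}` for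
all slots) the nine slots with `⟪A w, n⟫ ≤ 0` are occupied, the three with `⟪A w, n⟫ > 0` are EMPTY, and
their twin images `u − A w + 2⟪A w, n⟫ n` are occupied — the conclusion of `exit_twinCap_of_patch`,
here from the SHAPE of the shell alone (no full-shell predecessor, no radius-2 patch). -/
theorem twinCap_of_hcpShell
    (A : EuclideanSpace ℝ (Fin 3) ≃ₗᵢ[ℝ] EuclideanSpace ℝ (Fin 3))
    (B : EuclideanSpace ℝ (Fin 3) →ₗᵢ[ℝ] EuclideanSpace ℝ (Fin 3)) {u : EuclideanSpace ℝ (Fin 3)}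
    (hmem : ∀ p ∈ hcpKissingPattern, u + B p ∈ X)
    (hshell : ∀ q ∈ X, dist u q = 1 → ∃ p ∈ hcpKissingPattern, q = u + B p)
    {w₁ w₂ w₃ : EuclideanSpace ℝ (Fin 3)} (hw₁ : w₁ ∈ fccSlots) (hw₂ : w₂ ∈ fccSlots) (hw₃ : w₃ ∈ fccSlots)
    (h₁ : u + A w₁ ∈ X) (h₂ : u + A w₂ ∈ X) (h₃ : u + A w₃ ∈ X)
    (hind : LinearIndependent ℝ ![w₁, w₂, w₃]) :
    ∃ n : EuclideanSpace ℝ (Fin 3), ‖n‖ = 1 ∧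
      (∀ w ∈ fccSlots, ⟪A w, n⟫_ℝ = 0 ∨ ⟪A w, n⟫_ℝ = Real.sqrt (2 / 3) ∨ ⟪A w, n⟫_ℝ = -Real.sqrt (2 / 3)) ∧
      (∀ w ∈ fccSlots, ⟪A w, n⟫_ℝ ≤ 0 → u + A w ∈ X) ∧
      (∀ w ∈ fccSlots, 0 < ⟪A w, n⟫_ℝ → u + A w ∉ X ∧ u - A w + (2 * ⟪A w, n⟫_ℝ) • n ∈ X) := by
  obtain ⟨a₁, a₂⟩ := slot_mem_dozen_of_mem A B hshell hw₁ h₁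
  obtain ⟨b₁, b₂⟩ := slot_mem_dozen_of_mem A B hshell hw₂ h₂
  obtain ⟨c₁, c₂⟩ := slot_mem_dozen_of_mem A B hshell hw₃ h₃
  obtain ⟨n, hn1, hmenu, hdoz⟩ := hcpDozen_twin_of_three_independent A B a₁ b₁ c₁ a₂ b₂ c₂
    (linearIndependent_map_triple A hind)
  refine ⟨n, hn1, hmenu, fun w hw hle => ?_, fun w hw hlt => ⟨fun hX => ?_, ?_⟩⟩
  · -- non-positive slots are vectors of the dozen
    have : A w ∈ B '' (↑hcpKissingPattern : Set (EuclideanSpace ℝ (Fin 3))) := by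
      rw [hdoz]; exact Or.inl ⟨w, ⟨hw, hle⟩, rfl⟩
    obtain ⟨p, hp, he⟩ := this
    rw [← he]; exact hmem p hp
  · -- a positive slot is not a vector of the dozen
    obtain ⟨hB, -⟩ := slot_mem_dozen_of_mem A B hshell hw hX
    have := (slot_mem_twinDozen_iff A hn1 hmenu hdoz hw).1 (hdoz ▸ hB)
    linarith
  · -- the twin image of the antipodal slot `−w` is a vector of the dozen
    have hw' : -w ∈ fccSlots := neg_mem_fccSlots hw
    have hlt' : ⟪A (-w), n⟫_ℝ < 0 := by rw [map_neg, inner_neg_left]; linarith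
    have : A (-w) - (2 * ⟪A (-w), n⟫_ℝ) • n ∈ B '' (↑hcpKissingPattern : Set (EuclideanSpace ℝ (Fin 3))) := by
      rw [hdoz]; exact Or.inr ⟨-w, ⟨hw', hlt'⟩, rfl⟩
    obtain ⟨p, hp, he⟩ := this
    have e : u - A w + (2 * ⟪A w, n⟫_ℝ) • n = u + B p := by
      rw [he, map_neg, inner_neg_left]
      simp only [mul_neg, neg_smul, sub_neg_eq_add]
      abel
    rw [e]; exact hmem p hp

/-- **Shell trichotomy (E2 of the per-ball plan, cf-p1 ROUTE §80(9)).**  In any configuration `X`: if the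
contact shell of `u` is a CLOSE-PACKED dozen `u + B(P)`, `P ∈ {fccKissingPattern, hcpKissingPattern}`
(the output of `exists_frame_of_allButOne`, or of `ExactOnly` + saturation), and `u` has three linearly
independent occupied slots of the grain `A`, then either all twelve slots of `u` are occupied (interior
ball) or `u` is an exact twin cap of the grain. -/
theorem slots_full_or_twinCap_of_closePackedShell
    (A : EuclideanSpace ℝ (Fin 3) ≃ₗᵢ[ℝ] EuclideanSpace ℝ (Fin 3))
    (B : EuclideanSpace ℝ (Fin 3) →ₗᵢ[ℝ] EuclideanSpace ℝ (Fin 3)) {P : Finset (EuclideanSpace ℝ (Fin 3))}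
    (hP : P = fccKissingPattern ∨ P = hcpKissingPattern) {u : EuclideanSpace ℝ (Fin 3)}
    (hmem : ∀ p ∈ P, u + B p ∈ X)
    (hshell : ∀ q ∈ X, dist u q = 1 → ∃ p ∈ P, q = u + B p)
    {w₁ w₂ w₃ : EuclideanSpace ℝ (Fin 3)} (hw₁ : w₁ ∈ fccSlots) (hw₂ : w₂ ∈ fccSlots) (hw₃ : w₃ ∈ fccSlots)
    (h₁ : u + A w₁ ∈ X) (h₂ : u + A w₂ ∈ X) (h₃ : u + A w₃ ∈ X)
    (hind : LinearIndependent ℝ ![w₁, w₂, w₃]) :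
    (∀ w ∈ fccSlots, u + A w ∈ X) ∨
    ∃ n : EuclideanSpace ℝ (Fin 3), ‖n‖ = 1 ∧
      (∀ w ∈ fccSlots, ⟪A w, n⟫_ℝ = 0 ∨ ⟪A w, n⟫_ℝ = Real.sqrt (2 / 3) ∨ ⟪A w, n⟫_ℝ = -Real.sqrt (2 / 3)) ∧
      (∀ w ∈ fccSlots, ⟪A w, n⟫_ℝ ≤ 0 → u + A w ∈ X) ∧
      (∀ w ∈ fccSlots, 0 < ⟪A w, n⟫_ℝ → u + A w ∉ X ∧ u - A w + (2 * ⟪A w, n⟫_ℝ) • n ∈ X) := by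
  rcases hP with rfl | rfl
  · exact Or.inl (slots_full_of_fccShell A B hmem hshell hw₁ hw₂ hw₃ h₁ h₂ h₃ hind)
  · exact Or.inr (twinCap_of_hcpShell A B hmem hshell hw₁ hw₂ hw₃ h₁ h₂ h₃ hind)

/-- **With an empty slot the twin cap is forced.**  Same hypotheses plus one empty slot `u + A v ∉ X`:
then the shell is of hcp type and `u` is an exact twin cap. -/
theorem twinCap_of_closePackedShell_of_empty_slot
    (A : EuclideanSpace ℝ (Fin 3) ≃ₗᵢ[ℝ] EuclideanSpace ℝ (Fin 3))
    (B : EuclideanSpace ℝ (Fin 3) →ₗᵢ[ℝ] EuclideanSpace ℝ (Fin 3)) {P : Finset (EuclideanSpace ℝ (Fin 3))}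
    (hP : P = fccKissingPattern ∨ P = hcpKissingPattern) {u : EuclideanSpace ℝ (Fin 3)}
    (hmem : ∀ p ∈ P, u + B p ∈ X)
    (hshell : ∀ q ∈ X, dist u q = 1 → ∃ p ∈ P, q = u + B p)
    {w₁ w₂ w₃ : EuclideanSpace ℝ (Fin 3)} (hw₁ : w₁ ∈ fccSlots) (hw₂ : w₂ ∈ fccSlots) (hw₃ : w₃ ∈ fccSlots)
    (h₁ : u + A w₁ ∈ X) (h₂ : u + A w₂ ∈ X) (h₃ : u + A w₃ ∈ X)
    (hind : LinearIndependent ℝ ![w₁, w₂, w₃])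
    (hv : ∃ v ∈ fccSlots, u + A v ∉ X) :
    ∃ n : EuclideanSpace ℝ (Fin 3), ‖n‖ = 1 ∧
      (∀ w ∈ fccSlots, ⟪A w, n⟫_ℝ = 0 ∨ ⟪A w, n⟫_ℝ = Real.sqrt (2 / 3) ∨ ⟪A w, n⟫_ℝ = -Real.sqrt (2 / 3)) ∧
      (∀ w ∈ fccSlots, ⟪A w, n⟫_ℝ ≤ 0 → u + A w ∈ X) ∧
      (∀ w ∈ fccSlots, 0 < ⟪A w, n⟫_ℝ → u + A w ∉ X ∧ u - A w + (2 * ⟪A w, n⟫_ℝ) • n ∈ X) := by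
  rcases slots_full_or_twinCap_of_closePackedShell A B hP hmem hshell hw₁ hw₂ hw₃ h₁ h₂ h₃ hind with h | h
  · obtain ⟨v, hv, hvX⟩ := hv
    exact absurd (h v hv) hvX
  · exact h

end Summit.Ventures.Crystal3D.Theorems

end
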